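import Mathlib
import HarnessLib
import Summits.HubbardSuperconductivity.HubbardSuperconductivity.Theorems.KLProgrammeThermalGreenKMSBridge
import Summits.HubbardSuperconductivity.HubbardSuperconductivity.Theorems.KLProgrammeThermalGreenHubbardTorusFrame
import Summits.HubbardSuperconductivity.HubbardSuperconductivity.Theorems.KLProgrammeKLRegimeVolumeLimitWordTranslationInvariance
import Summits.HubbardSuperconductivity.HubbardSuperconductivity.Theorems.KLProgrammeKLRegimeVolumeLimitBoundFinal

/-!
# (P3): the Hamiltonian bound of `stub_vl_bound_of_hamiltonianBound` from the time-resolved two-point identification (H1)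
# (seat hubbard-kl-k3c5-p2, g3, «analytic-continuation-free assembly via FinalTwoLegVolLimit»)

Route `KLProgramme`, gen-4 child 5 `KLRegimeVolumeLimitV12` (stmt-HubbardSuperconductivity-19858), stub `stub_vl_bound`.  k3c5-p3's
`stub_vl_bound_of_hamiltonianBound` (`…VolumeLimitBoundFinal`, every coupling) reduces the registered stub to ONE inequality per
`(β, U, μ, L ≥ 3, n, p)`:

  `‖(Iinf n p / D∞ + ĝ)/ĝ²‖ ≤ BH β U μ`,   `Iinf n p = ∫₀^β Σ_x e^{−ik₀s} conj χ_p(x) · Pinf x s ds`,   `Pinf x s = lim_M ∫dμ_{C_M}ψ⁺_{(x,s)↑}ψ⁻_{(0,0)↑}e^{−V}`,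

`k₀ = (2n+1)π/β`, `ĝ = 1/(−ik₀ + ε(p) − μ)`, `D∞ = e^{−βUL²/4}Z_{H'}/Z_{H₀}`.  This module proves that inequality, with
`BH β U μ = (1 + |U/2|β/π)(|U/2| + (1 + |U/2|β/π)|U|(2 + β|U|))` (INDEPENDENT of `L`, `n`, `p`), from the time-resolved Hamiltonian
identification (H1) of the `1+1` word (k3c5-p1 g4, `hasSum_twoPointLimitDet_series_time` + k3c5-p2 p470680), taken here as the hypothesis

  (H1)  `∀ x y, ∀ s ∈ (0,β), ∫dμ_{C_M}ψ⁺_{(x,s)↑}ψ⁻_{(y,0)↑}e^{−V} ⟶ e^{−βUL²/4}·Tr(e^{−(β−s)H'} c†_{x↑} e^{−sH'} c_{y↑}) / Z_{H₀}`,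
        `H' = hubbardTorusWith 2 L 1 U (μ + U/2)`, `H₀ = hubbardTorusWith 2 L 1 0 μ`.

Chain (`hamiltonianBound_of_H1`): `Pinf x s = ` the (H1) value for a.e. `s` (`limUnder` of a convergent sequence); translation invariance of the
(H1) values `val(x,y,s) = val(x−y,0,s)` is INHERITED from the finite-cutoff invariance of the Grassmann word (k3c5-p2 p481814
`gaussExpect_positionWord_translate`) by uniqueness of limits, whence `Σ_x conj χ_p(x) val(x,0,s) = L⁻² Σ_{x,y} conj χ_p(x) χ_p(y) val(x,y,s)`;
`val/D∞ = Tr(e^{−(β−s)H'}c†_x e^{−sH'}c_y)/Z_{H'} = ⟨c_y(β−s) c†_x⟩_{H'}` (two-time trace algebra + KMS, `…ThermalGreenKMSBridge`); the Bloch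
sums and the reflection `s ↦ β − s` (`e^{ik₀β} = −1`) give **`Iinf n p / D∞ = −𝒢_{H'}(k₀, −p)`**, the Matsubara Green function of
`…ThermalGreenHubbardTorus*`; so `(Iinf/D∞ + ĝ)/ĝ² = (ĝ − 𝒢)(−ik₀ + ξ_p)²` with `ξ_p = ε(−p) − (μ + U/2) + U/2` — k3c5-p2 g2's FRAME form
`norm_reamputated_matsubaraGreen_frame_le_fermi` at chemical potential `μ + U/2`, shift `κ = U/2`, momentum `−p`, for EVERY coupling.
Finally `stub_vl_bound_of_H1`: (H1) at every `L ≥ 3`, `β > 0`, `U`, `μ` ⟹ the REGISTERED `stub_vl_bound` text verbatim.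
Everything is proved; no definition; no smallness.
-/

noncomputable section

namespace Summit.HubbardSuperconductivity.HubbardSuperconductivity.Theorems.TwoPointAssembly

set_option linter.dupNamespace false -- summit = problem name (single-conjunct summit), D-0017

open Finset Filter Topology MeasureTheory intervalIntegral Complex Literature.MathematicalPhysics.QuantumLattice Literature.Probability.LatticeModels
  GrassmannAlgebra
open Summit.HubbardSuperconductivity.HubbardSuperconductivity.Theorems.ThermalGreen
open Summit.HubbardSuperconductivity.HubbardSuperconductivity.Theorems.KLRegimeSplit
open Summit.HubbardSuperconductivity.HubbardSuperconductivity.Theorems.KLProgrammeLegKernels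
open scoped ComplexConjugate ComplexOrder Matrix.Norms.L2Operator

/-! ## §1 Hamiltonian side: two-time traces, KMS, Bloch sums, reflection of the Matsubara integral -/

section Hamiltonian

variable {n : Type*} [Fintype n] [DecidableEq n]

/-- **Two-time trace algebra**: `Tr(e^{−(β−τ)H} X e^{−τH} Y) = Tr(e^{−βH} · X(τ) · Y)`, `X(τ) = e^{τH}Xe^{−τH}` (real `τ`). -/
theorem trace_gibbsWeight_twoTime (β τ : ℝ) (H X Y : Matrix n n ℂ) :
    (Matrix.gibbsWeight (β - τ) H * X * (Matrix.gibbsWeight τ H * Y)).trace =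
      (Matrix.gibbsWeight β H * (Matrix.imagTimeEvolve H (τ : ℂ) X * Y)).trace := by
  have h1 : Matrix.gibbsWeight (β - τ) H = Matrix.gibbsWeight β H * NormedSpace.exp ((τ : ℂ) • H) := by
    rw [Matrix.gibbsWeight, Matrix.gibbsWeight, ← Matrix.exp_add_of_commute _ _ (((Commute.refl H).smul_left _).smul_right _),
      ← add_smul]
    congr 1
    push_cast
    ring
  have h2 : Matrix.gibbsWeight τ H = NormedSpace.exp (-((τ : ℂ) • H)) := by rw [Matrix.gibbsWeight, neg_smul]
  rw [h1, h2, Matrix.imagTimeEvolve_eq]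
  simp only [Matrix.mul_assoc]

/-- The same inside the Gibbs state: `Tr(e^{−(β−τ)H} X e^{−τH} Y)/Z = ⟨X(τ) Y⟩_β`. -/
theorem trace_gibbsWeight_twoTime_div (β τ : ℝ) (H X Y : Matrix n n ℂ) :
    (Matrix.gibbsWeight (β - τ) H * X * (Matrix.gibbsWeight τ H * Y)).trace / Matrix.partitionFn β H =
      Matrix.gibbsState β H (Matrix.imagTimeEvolve H (τ : ℂ) X * Y) := by
  rw [trace_gibbsWeight_twoTime, Matrix.gibbsState_apply, div_eq_inv_mul]

end Hamiltonian

variable {L : ℕ} [NeZero L]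

/-- `χ_{−k}(x) = conj χ_k(x)`. -/
theorem torusChar_neg_left' (k x : TorusSite 2 L) : torusChar (-k) x = conj (torusChar k x) := by
  rw [torusChar_comm, torusChar_neg_right, torusChar_comm]

/-- **Reflection of the Matsubara integral** (`e^{ik₀β} = −1`): for the Hamiltonian `H` and operators `A, B`,
`∫₀^β e^{ik₀τ}⟨A(τ)B⟩dτ = −∫₀^β e^{−ik₀s}⟨A(β−s)B⟩ds`. -/
theorem matsubara_integral_reflect {m : Type*} [Fintype m] [DecidableEq m] (β : ℝ) (H A B : Matrix m m ℂ) {k₀ : ℝ}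
    (hk : cexp (I * k₀ * β) = -1) :
    (∫ τ in (0 : ℝ)..β, cexp (I * k₀ * τ) * Matrix.gibbsState β H (Matrix.imagTimeEvolve H (τ : ℂ) A * B)) =
      -∫ s in (0 : ℝ)..β, cexp (-(((k₀ * s : ℝ) : ℂ) * I)) *
        Matrix.gibbsState β H (Matrix.imagTimeEvolve H ((β - s : ℝ) : ℂ) A * B) := by
  have hsub := intervalIntegral.integral_comp_sub_left
    (fun τ : ℝ => cexp (I * k₀ * τ) * Matrix.gibbsState β H (Matrix.imagTimeEvolve H (τ : ℂ) A * B)) (a := 0) (b := β) β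
  simp only [sub_self, sub_zero] at hsub
  rw [← hsub, ← intervalIntegral.integral_neg]
  refine intervalIntegral.integral_congr fun s _ => ?_
  have hph : cexp (I * k₀ * ((β - s : ℝ) : ℂ)) = -cexp (-(((k₀ * s : ℝ) : ℂ) * I)) := by
    have : I * k₀ * ((β - s : ℝ) : ℂ) = I * k₀ * β + -(((k₀ * s : ℝ) : ℂ) * I) := by push_cast; ring
    rw [this, Complex.exp_add, hk]
    ring
  simp only [hph]
  ring

/-- **The Matsubara Green function of a Bloch mode as a reflected site double sum** (`e^{ik₀β} = −1`, `H = hubbardTorusWith 2 L 1 U μ'`):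
`𝒢(k₀,q) = −∫₀^β e^{−ik₀s} Σ_{y,x} L⁻¹conj χ_q(y)·L⁻¹χ_q(x)·⟨c_y(β−s) c†_x⟩ ds` (torus sites). -/
theorem matsubaraGreen_eq_neg_integral_siteSum (U μ' β : ℝ) (q : TorusSite 2 L) {k₀ : ℝ} (hk : cexp (I * k₀ * β) = -1) :
    (∫ τ in (0 : ℝ)..β, cexp (I * k₀ * τ) * Matrix.gibbsState β (hubbardTorusWith 2 L 1 U μ')
        (Matrix.imagTimeEvolve (hubbardTorusWith 2 L 1 U μ') (τ : ℂ) (momentumAnnihilation q 0) * momentumCreation q 0)) =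
      -∫ s in (0 : ℝ)..β, cexp (-(((k₀ * s : ℝ) : ℂ) * I)) *
        ∑ y : TorusSite 2 L, ∑ x : TorusSite 2 L,
          (torusFourierWeight 2 L * conj (torusChar q y)) * (torusFourierWeight 2 L * torusChar q x) *
            Matrix.gibbsState β (hubbardTorusWith 2 L 1 U μ')
              (Matrix.imagTimeEvolve (hubbardTorusWith 2 L 1 U μ') ((β - s : ℝ) : ℂ)
                  (annihilation (orb (FermionTorus.ofTorusSite y) 0)) * creation (orb (FermionTorus.ofTorusSite x) 0)) := by
  rw [matsubara_integral_reflect β _ _ _ hk]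
  congr 1
  refine intervalIntegral.integral_congr fun s _ => ?_
  simp only [gibbsState_momentum_evolve_eq_sum]
  congr 1
  refine Fintype.sum_equiv (FermionTorus.equivTorusSite (d := 2) (L := L)) _ _ fun y => ?_
  refine Fintype.sum_equiv (FermionTorus.equivTorusSite (d := 2) (L := L)) _ _ fun x => ?_
  simp [FermionTorus.equivTorusSite]

/-! ## §2 Grassmann side under (H1): translation invariance of the limits, single sum = double sum -/

/-- **Finite-cutoff translation invariance of the two-point word** (k3c5-p2 p481814): `W_M(x,y,s) = W_M(x−y,0,s)`. -/
theorem twoPointWord_translate {M : ℕ} (β U μ : ℝ) (σ : Fin 2) (x y : TorusSite 2 L) (s : ℝ) :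
    gaussExpect ℂ (hubbardCovariance L M β μ 0)
        (positionField L M β 0 σ x s * positionField L M β 1 σ y 0 * grassmannExp (-(hubbardInteraction L M β U))) =
      gaussExpect ℂ (hubbardCovariance L M β μ 0)
        (positionField L M β 0 σ (x - y) s * positionField L M β 1 σ 0 0 * grassmannExp (-(hubbardInteraction L M β U))) := by
  have h := gaussExpect_positionWord_translate (L := L) (M := M) β U μ 0 y
    [((0 : Fin 2), σ, x - y, s), ((1 : Fin 2), σ, (0 : TorusSite 2 L), (0 : ℝ))]
  simp only [List.map_cons, List.map_nil, List.prod_cons, List.prod_nil, mul_one, sub_add_cancel, zero_add, add_zero] at h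
  exact h

/-! ## §3 The Hamiltonian bound from (H1) -/

/-- **(P3): THE HAMILTONIAN BOUND OF `stub_vl_bound_of_hamiltonianBound` FROM (H1)**, for EVERY coupling: for `L ≥ 3`, `β > 0`, real `U, μ`,
under the time-resolved identification (H1) of the `1+1` word (spin `↑`, all pairs of sites, `s ∈ (0,β)`), for every Matsubara integer `n` and
torus momentum `p`:
`‖(Iinf n p / D∞ + ĝ)/ĝ²‖ ≤ (1 + |U/2|β/π)·(|U/2| + (1 + |U/2|β/π)·|U|(2 + β|U|))` — independent of `L`, `n`, `p`. -/
theorem hamiltonianBound_of_H1 (hL : 3 ≤ L) {β : ℝ} (hβ : 0 < β) (U μ : ℝ)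
    (hH1 : ∀ (x y : TorusSite 2 L), ∀ s ∈ Set.Ioo (0 : ℝ) β,
      Tendsto (fun M : ℕ => gaussExpect ℂ (hubbardCovariance L M β μ 0)
          (positionField L M β 0 0 x s * positionField L M β 1 0 y 0 * grassmannExp (-(hubbardInteraction L M β U)))) atTop
        (𝓝 ((Real.exp (-(β * U / 4 * (L : ℝ) ^ 2)) : ℂ) *
          (Matrix.gibbsWeight (β - s) (hubbardTorusWith 2 L 1 U (μ + U / 2)) * creation (orb (FermionTorus.ofTorusSite x) 0) *
            (Matrix.gibbsWeight s (hubbardTorusWith 2 L 1 U (μ + U / 2)) * annihilation (orb (FermionTorus.ofTorusSite y) 0))).trace /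
          Matrix.partitionFn β (hubbardTorusWith 2 L 1 0 μ))))
    (n : ℤ) (p : TorusSite 2 L) :
    ‖((∫ s in (0 : ℝ)..β, ∑ x : TorusSite 2 L,
          Complex.exp (-(((Real.pi * (2 * (n : ℝ) + 1) / β * s : ℝ) : ℂ) * Complex.I)) * conj (torusChar p x) *
            limUnder atTop (fun M : ℕ => gaussExpect ℂ (hubbardCovariance L M β μ 0)
              (positionField L M β 0 0 x s * positionField L M β 1 0 0 0 * grassmannExp (-(hubbardInteraction L M β U))))) /
          (((Real.exp (-(β * U / 4 * (L : ℝ) ^ 2)) : ℝ) : ℂ) * Matrix.partitionFn β (hubbardTorusWith 2 L 1 U (μ + U / 2)) /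
            Matrix.partitionFn β (hubbardTorusWith 2 L 1 0 μ)) +
        1 / (-Complex.I * ((Real.pi * (2 * (n : ℝ) + 1) / β : ℝ) : ℂ) + (nambuXiCT L μ 0 p : ℂ))) /
        (1 / (-Complex.I * ((Real.pi * (2 * (n : ℝ) + 1) / β : ℝ) : ℂ) + (nambuXiCT L μ 0 p : ℂ))) ^ 2‖ ≤
      (1 + |U / 2| * β / Real.pi) * (|U / 2| + (1 + |U / 2| * β / Real.pi) * (|U| * (2 + β * |U|))) := by
  haveI : Nonempty (Finset (Orb (FermionTorus 2 L))) := ⟨∅⟩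
  -- names
  set H' := hubbardTorusWith 2 L 1 U (μ + U / 2) with hH'
  set Ec : ℂ := ((Real.exp (-(β * U / 4 * (L : ℝ) ^ 2)) : ℝ) : ℂ) with hEc
  set Z₀ : ℂ := Matrix.partitionFn β (hubbardTorusWith 2 L 1 0 μ) with hZ₀
  set Z' : ℂ := Matrix.partitionFn β H' with hZ'
  set k₀ : ℝ := Real.pi * (2 * (n : ℝ) + 1) / β with hk₀
  have hk₀f : k₀ = fermiMatsubara β n := rfl
  have hk : cexp (I * k₀ * β) = -1 := by rw [hk₀f]; exact cexp_fermiMatsubara_mul_beta hβ.ne' n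
  have hZ₀ne : Z₀ ≠ 0 := (Matrix.partitionFn_pos β (isHermitian_hamiltonianWith (fermionTorusGraph 2 L) 1 0 μ)).ne'
  have hZ'ne : Z' ≠ 0 := (Matrix.partitionFn_pos β (isHermitian_hamiltonianWith (fermionTorusGraph 2 L) 1 U (μ + U / 2))).ne'
  have hEne : Ec ≠ 0 := by rw [hEc]; exact_mod_cast (Real.exp_pos _).ne'
  have hDne : Ec * Z' / Z₀ ≠ 0 := div_ne_zero (mul_ne_zero hEne hZ'ne) hZ₀ne
  -- the (H1) values and the words
  obtain ⟨val, hval⟩ : ∃ val : TorusSite 2 L → TorusSite 2 L → ℝ → ℂ, ∀ x y s, val x y s =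
      Ec * (Matrix.gibbsWeight (β - s) H' * creation (orb (FermionTorus.ofTorusSite x) 0) *
        (Matrix.gibbsWeight s H' * annihilation (orb (FermionTorus.ofTorusSite y) 0))).trace / Z₀ := ⟨_, fun _ _ _ => rfl⟩
  obtain ⟨W, hW⟩ : ∃ W : ℕ → TorusSite 2 L → TorusSite 2 L → ℝ → ℂ, ∀ M x y s, W M x y s = gaussExpect ℂ (hubbardCovariance L M β μ 0)
      (positionField L M β 0 0 x s * positionField L M β 1 0 y 0 * grassmannExp (-(hubbardInteraction L M β U))) :=
    ⟨_, fun _ _ _ _ => rfl⟩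
  have hH1' : ∀ x y, ∀ s ∈ Set.Ioo (0 : ℝ) β, Tendsto (fun M : ℕ => W M x y s) atTop (𝓝 (val x y s)) := by
    intro x y s hs; simp only [hW, hval]; exact hH1 x y s hs
  -- `limUnder` = the (H1) value, and translation invariance of the values
  have hlim : ∀ x, ∀ s ∈ Set.Ioo (0 : ℝ) β, limUnder atTop (fun M : ℕ => W M x 0 s) = val x 0 s := fun x s hs => (hH1' x 0 s hs).limUnder_eq
  have htrans : ∀ x y, ∀ s ∈ Set.Ioo (0 : ℝ) β, val x y s = val (x - y) 0 s := by
    intro x y s hs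
    refine tendsto_nhds_unique (hH1' x y s hs) ?_
    have h := hH1' (x - y) 0 s hs
    have heq : (fun M : ℕ => W M x y s) = fun M : ℕ => W M (x - y) 0 s := funext fun M => by
      rw [hW, hW]; exact twoPointWord_translate β U μ 0 x y s
    rw [heq]; exact h
  -- single sum = double sum on the values
  have hsd : ∀ s ∈ Set.Ioo (0 : ℝ) β, ∑ x : TorusSite 2 L, conj (torusChar p x) * val x 0 s =
      ((L : ℂ) ^ 2)⁻¹ * ∑ x : TorusSite 2 L, ∑ y : TorusSite 2 L, conj (torusChar p x) * torusChar p y * val x y s := by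
    intro s hs
    have hL2 : ((L : ℂ) ^ 2) ≠ 0 := pow_ne_zero 2 (by exact_mod_cast NeZero.ne L)
    have hinner : ∀ y : TorusSite 2 L, ∑ x : TorusSite 2 L, conj (torusChar p x) * torusChar p y * val x y s =
        ∑ z : TorusSite 2 L, conj (torusChar p z) * val z 0 s := by
      intro y
      have hre : ∑ x : TorusSite 2 L, conj (torusChar p x) * torusChar p y * val x y s =
          ∑ z : TorusSite 2 L, conj (torusChar p (z + y)) * torusChar p y * val (z + y) y s :=
        (Fintype.sum_equiv (Equiv.addRight y) _ _ fun z => rfl).symm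
      rw [hre]
      refine Finset.sum_congr rfl fun z _ => ?_
      rw [htrans _ _ s hs, add_sub_cancel_right, torusChar_add_right, map_mul]
      have h1 : conj (torusChar p y) * torusChar p y = 1 := by rw [mul_comm, torusChar_mul_conj]
      calc conj (torusChar p z) * conj (torusChar p y) * torusChar p y * val z 0 s
          = conj (torusChar p z) * (conj (torusChar p y) * torusChar p y) * val z 0 s := by ring
        _ = conj (torusChar p z) * val z 0 s := by rw [h1, mul_one]
    rw [Finset.sum_comm]
    simp_rw [hinner]
    rw [Finset.sum_const, Finset.card_univ, nsmul_eq_mul]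
    have hcard : ((Fintype.card (TorusSite 2 L) : ℕ) : ℂ) = (L : ℂ) ^ 2 := by
      rw [Fintype.card_pi, prod_const, ZMod.card, card_univ, Fintype.card_fin]; push_cast; ring
    rw [hcard, ← mul_assoc, inv_mul_cancel₀ hL2, one_mul]
  -- value / D∞ = the reflected two-time Gibbs correlation
  have hvalD : ∀ x y (s : ℝ), val x y s / (Ec * Z' / Z₀) =
      Matrix.gibbsState β H' (Matrix.imagTimeEvolve H' ((β - s : ℝ) : ℂ) (annihilation (orb (FermionTorus.ofTorusSite y) 0)) *
        creation (orb (FermionTorus.ofTorusSite x) 0)) := by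
    intro x y s
    rw [gibbsState_imagTimeEvolve_mul_kms]
    have : ((β : ℂ) - ((β - s : ℝ) : ℂ)) = ((s : ℝ) : ℂ) := by push_cast; ring
    rw [this, ← trace_gibbsWeight_twoTime_div, ← hZ', hval]
    field_simp
  -- the integral of hB, rewritten through (H1)
  have hae : ∀ᵐ s ∂(volume : Measure ℝ), s ∈ Set.uIoc (0 : ℝ) β → s ∈ Set.Ioo (0 : ℝ) β := by
    have h : ∀ᵐ u ∂(volume : Measure ℝ), u ∉ ({β} : Set ℝ) := measure_eq_zero_iff_ae_notMem.1 Real.volume_singleton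
    filter_upwards [h] with s hs hsI
    rw [Set.uIoc_of_le hβ.le] at hsI
    exact ⟨hsI.1, lt_of_le_of_ne hsI.2 fun h => hs (Set.mem_singleton_iff.2 h)⟩
  have hI : (∫ s in (0 : ℝ)..β, ∑ x : TorusSite 2 L,
        Complex.exp (-(((k₀ * s : ℝ) : ℂ) * Complex.I)) * conj (torusChar p x) * limUnder atTop (fun M : ℕ => W M x 0 s)) /
        (Ec * Z' / Z₀) =
      -∫ τ in (0 : ℝ)..β, cexp (I * k₀ * τ) * Matrix.gibbsState β H'
        (Matrix.imagTimeEvolve H' (τ : ℂ) (momentumAnnihilation (-p) 0) * momentumCreation (-p) 0) := by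
    rw [hH', matsubaraGreen_eq_neg_integral_siteSum U (μ + U / 2) β (-p) hk, neg_neg, ← hH', ← intervalIntegral.integral_div]
    refine intervalIntegral.integral_congr_ae ?_
    filter_upwards [hae] with s hsI hsu
    have hs := hsI hsu
    -- left: (H1) values, single → double sum, divide
    have hleft : (∑ x : TorusSite 2 L, Complex.exp (-(((k₀ * s : ℝ) : ℂ) * Complex.I)) * conj (torusChar p x) *
        limUnder atTop (fun M : ℕ => W M x 0 s)) / (Ec * Z' / Z₀) =
        Complex.exp (-(((k₀ * s : ℝ) : ℂ) * Complex.I)) * (((L : ℂ) ^ 2)⁻¹ *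
          ∑ x : TorusSite 2 L, ∑ y : TorusSite 2 L, conj (torusChar p x) * torusChar p y * (val x y s / (Ec * Z' / Z₀))) := by
      have h1 : ∑ x : TorusSite 2 L, Complex.exp (-(((k₀ * s : ℝ) : ℂ) * Complex.I)) * conj (torusChar p x) *
          limUnder atTop (fun M : ℕ => W M x 0 s) =
          Complex.exp (-(((k₀ * s : ℝ) : ℂ) * Complex.I)) * ∑ x : TorusSite 2 L, conj (torusChar p x) * val x 0 s := by
        rw [Finset.mul_sum]
        refine Finset.sum_congr rfl fun x _ => ?_
        rw [hlim x s hs, mul_assoc]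
      rw [h1, hsd s hs, mul_div_assoc, mul_div_assoc, Finset.sum_div]
      congr 2
      refine Finset.sum_congr rfl fun x _ => ?_
      rw [Finset.sum_div]
      refine Finset.sum_congr rfl fun y _ => ?_
      rw [mul_div_assoc]
    rw [hleft, Finset.mul_sum]
    simp_rw [Finset.mul_sum]
    rw [Finset.sum_comm]
    refine Finset.sum_congr rfl fun a _ => Finset.sum_congr rfl fun b _ => ?_
    rw [hvalD, torusChar_neg_left', torusChar_neg_left', Complex.conj_conj]
    have hw : torusFourierWeight 2 L * torusFourierWeight 2 L = ((L : ℂ) ^ 2)⁻¹ := torusFourierWeight_mul_self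
    rw [← hw]
    ring
  -- the amputation algebra and the frame bound
  have hWlim : (fun s : ℝ => ∑ x : TorusSite 2 L, Complex.exp (-(((k₀ * s : ℝ) : ℂ) * Complex.I)) * conj (torusChar p x) *
      limUnder atTop (fun M : ℕ => gaussExpect ℂ (hubbardCovariance L M β μ 0)
        (positionField L M β 0 0 x s * positionField L M β 1 0 0 0 * grassmannExp (-(hubbardInteraction L M β U))))) =
      fun s : ℝ => ∑ x : TorusSite 2 L, Complex.exp (-(((k₀ * s : ℝ) : ℂ) * Complex.I)) * conj (torusChar p x) *
        limUnder atTop (fun M : ℕ => W M x 0 s) := by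
    funext s
    refine Finset.sum_congr rfl fun x _ => ?_
    congr 2
    funext M
    rw [hW]
  rw [hWlim, hI]
  -- the denominator `−ik₀ + ξ_p` is the frame lemma's `−ik₀ + (ε(−p) − (μ + U/2)) + U/2`
  have hDp : (-Complex.I * ((k₀ : ℝ) : ℂ) + ((nambuXiCT L μ 0 p : ℝ) : ℂ)) =
      -I * ((k₀ : ℝ) : ℂ) + ((torusBand L (-p) - (μ + U / 2) : ℝ) : ℂ) + ((U / 2 : ℝ) : ℂ) := by
    rw [nambuXiCT_zero_frame, nambuXi, torusBand_neg]
    push_cast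
    ring
  set G : ℂ := ∫ τ in (0 : ℝ)..β, cexp (I * k₀ * τ) * Matrix.gibbsState β H'
    (Matrix.imagTimeEvolve H' (τ : ℂ) (momentumAnnihilation (-p) 0) * momentumCreation (-p) 0) with hG
  set Dp : ℂ := -Complex.I * ((k₀ : ℝ) : ℂ) + ((nambuXiCT L μ 0 p : ℝ) : ℂ) with hDpdef
  have hDpne : Dp ≠ 0 := by
    intro h
    have := congrArg Complex.im h
    simp [hDpdef] at this
    have hk0 : k₀ ≠ 0 := ne_zero_of_cexp_eq_neg_one hk
    exact hk0 this
  have halg : (-G + 1 / Dp) / (1 / Dp) ^ 2 = (1 / Dp - G) * Dp ^ 2 := by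
    field_simp
    ring
  rw [halg, hDp]
  have hframe := norm_reamputated_matsubaraGreen_frame_le_fermi hL U (μ + U / 2) (U / 2) hβ (-p) n
  rw [← hk₀f] at hframe
  exact hframe

/-- **`stub_vl_bound` FROM (H1)** — the REGISTERED stub text verbatim, for EVERY coupling, from the time-resolved two-point identification
(H1) at every volume `L ≥ 3`, every `β > 0` and real `U, μ` (k3c5-p3's `stub_vl_bound_of_hamiltonianBound` ∘ `hamiltonianBound_of_H1`). -/
theorem stub_vl_bound_of_H1
    (hH1 : ∀ β : ℝ, 0 < β → ∀ (U μ : ℝ) (L : ℕ) [NeZero L], 3 ≤ L → ∀ (x y : TorusSite 2 L), ∀ s ∈ Set.Ioo (0 : ℝ) β,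
      Tendsto (fun M : ℕ => gaussExpect ℂ (hubbardCovariance L M β μ 0)
          (positionField L M β 0 0 x s * positionField L M β 1 0 y 0 * grassmannExp (-(hubbardInteraction L M β U)))) atTop
        (𝓝 ((Real.exp (-(β * U / 4 * (L : ℝ) ^ 2)) : ℂ) *
          (Matrix.gibbsWeight (β - s) (hubbardTorusWith 2 L 1 U (μ + U / 2)) * creation (orb (FermionTorus.ofTorusSite x) 0) *
            (Matrix.gibbsWeight s (hubbardTorusWith 2 L 1 U (μ + U / 2)) * annihilation (orb (FermionTorus.ofTorusSite y) 0))).trace /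
          Matrix.partitionFn β (hubbardTorusWith 2 L 1 0 μ)))) :
    ∀ (G : GeoConsts) (P : SplitConsts) (Q : EngConsts) (R : RenConsts), G.WF → P.WF → Q.WF → R.WF →
      ∃ c₅ : ℝ, 0 < c₅ ∧ ∀ c : ℝ, 0 < c → c ≤ c₅ → ∃ U₀ : ℝ, 0 < U₀ ∧
        ∀ μ ∈ klWindowC, ∀ U : ℝ, 0 < U → U ≤ U₀ → ∀ β : ℝ, klBetaMin ≤ β → β ≤ Real.exp (c / U ^ 2) →
          ∀ K : TrigPolyC4v, klPredsV12.frameOK R U (nScales β) μ K →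
            ∀ (Lstar : ℕ) (Mstar : ℕ → ℕ), TowerP klPredsV12 G P Q R β U μ K Lstar Mstar →
              ∃ B : ℝ, ∃ L₀ : ℕ, ∃ Mth : ℕ → ℕ, ∀ (L : ℕ) [NeZero L], L₀ ≤ L → ∀ (M : ℕ) [NeZero M], Mth L ≤ M →
                ∀ (k : FreqMomentum L M) (σ : Fin 2), ‖klSelfEnergy L M β U μ K klE0 (nScales β + 1) k σ‖ ≤ B :=
  stub_vl_bound_of_hamiltonianBound
    (fun β U _ => (1 + |U / 2| * β / Real.pi) * (|U / 2| + (1 + |U / 2| * β / Real.pi) * (|U| * (2 + β * |U|))))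
    fun β hβ U μ L _ hL n p => hamiltonianBound_of_H1 hL hβ U μ (hH1 β hβ U μ L hL) n p

end Summit.HubbardSuperconductivity.HubbardSuperconductivity.Theorems.TwoPointAssembly

end
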